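import Literature.Computability.MetaComplexity.MCSPTableWalk
import Literature.Computability.Complexity.UnaryBricks
import Literature.Computability.Complexity.PlumbingBricks
import Literature.Computability.Complexity.StackWords
import HarnessLib

/-!
# The `MCSP` table machine, III: the hybrid truth table is in `FP` (proofs)

Part of the proof architecture of the named fact `AllenderEtAl2006_MCSP_universalInverter`
(`MCSPUniversalInverter.lean`; Allender–Buhrman–Koucký–van Melkebeek–Ronneburger 2006, Thm. 45
with §4.2). This file DISCHARGES the hypothesis `hTab` of the capstone
`mcsp_universalInverter_of_hill_of_tables` (`MCSPUniversalInverterReduction.lean`): for every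
length-doubling `G ∈ FP` and every polynomial `D` there is a string function `h ∈ FP` which, on
`⟨⟨y, z⟩, ρ⟩` with `|z| = 2ℓ` and `k + ℓ + 2^{k+1} ℓ ≤ |ρ|` (`k = 4 |bin D(ℓ)|`), outputs the
truth table of the leaf-bit function of the depth-`k` distinguisher tree of the halves of
`s ↦ G ⟨y, s⟩`, with the step number read off the first `k` coins, the root label off the next
`ℓ`, the fresh labels off the following `2^{k+1}` blocks, and the halves of `z` as challenge
(`exists_tableFunction`) — the machine of the printed proof of Thm. 45 (p. 24 of the author
version: the statistical test is fed the pseudorandom/hybrid string; "as in [RR97]").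

Construction: parse the input (`halfFn`, `polyFn`, `lenBinF`, `onesFn`, `appF`, `takeFn`,
`dropFn`, `norm`, `powFn`), then a counted loop (`Brick.loopFn_mem_FP`) over the leaf numbers
`t = 2ᵏ − 1, …, 0`, each round prepending the first bit (`headBitFn`) of the leaf label computed
by the walk of `MCSPTableWalk.lean` (`exists_walk`).

* `boolFunEquivFin_getD_eq_bitsToNat_take` — the step number (via the tree's
  `testBit_bitsToNat_eq_getD`, `StackWords.lean`);
* **`exists_tableFunction`**.

Theorems only.

## References

* E. Allender et al., *Power from random strings*, SIAM J. Comput. 35(6) (2006)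
  [AllenderEtAl2006]: proof of Thm. 45 (p. 24).
* A. A. Razborov, S. Rudich, *Natural proofs*, JCSS 55 (1997) [RazborovRudich1997]: proof of
  Thm. 4.1.
* S. Arora, B. Barak, *Computational Complexity: A Modern Approach*, CUP 2009 [AroraBarak2009]:
  §1.3 (bounded loops), proof of Thm. 9.17.
-/

namespace Literature.Computability.MetaComplexity

open _root_.Computability Complexity Complexity.Brick Complexity.Plumb Complexity.HashBricks
  Complexity.TimeConstructible

/-! ### The step number -/

/-- **The step number**: the point of the cube read off the first `k` coins is the value of the
`k`-bit prefix. [folklore] -/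
theorem boolFunEquivFin_getD_eq_bitsToNat_take (ρ : List Bool) {k : ℕ} (hk : k ≤ ρ.length) :
    ((boolFunEquivFin k fun t : Fin k => ρ.getD t false) : ℕ) = bitsToNat (ρ.take k) := by
  apply boolFunEquivFin_apply_eq_of_testBit
  · have h := bitsToNat_lt (ρ.take k)
    rwa [List.length_take, min_eq_left hk] at h
  · intro j
    rw [testBit_bitsToNat_eq_getD, List.getD_eq_getElem?_getD, List.getD_eq_getElem?_getD,
      List.getElem?_take_of_lt j.isLt]

/-! ### Small facts -/

/-- `1ᵐ` is the unary numeral. [folklore] -/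
private theorem ones_eq_unaryEncodeNat' (m : ℕ) : ones m = unaryEncodeNat m :=
  (OracleCompose.unaryEncodeNat_eq_replicate m).symm

/-- `powFn 1 (1ᵐ) = bin 2ᵐ`. [folklore] -/
private theorem powFn_one_ones' (m : ℕ) : powFn 1 (ones m) = encodeNat (2 ^ m) := by
  rw [ones_eq_unaryEncodeNat', powFn_unary, pow_one]

/-- `onesFn w = 1^{|w|}`. [folklore] -/
private theorem onesFn_eq_ones (w : List Bool) : onesFn w = ones w.length := by
  rw [onesFn, ones_eq_unaryEncodeNat']

/-- The first entry of a nonempty `List.ofFn`. [folklore] -/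
private theorem headD_ofFn {ℓ : ℕ} (hℓ : 0 < ℓ) (f : Fin ℓ → Bool) :
    (List.ofFn f).headD false = f ⟨0, hℓ⟩ := by
  obtain ⟨m, rfl⟩ : ∃ m, ℓ = m + 1 := ⟨ℓ - 1, by omega⟩
  rw [List.ofFn_succ]
  rfl

/-! ### The table function -/

/-- **The hybrid truth table is computable in polynomial time** (discharge of the hypothesis
`hTab` of `mcsp_universalInverter_of_hill_of_tables`). For every length-doubling `G ∈ FP` and
every polynomial `D` there is `h ∈ FP` such that, for `ℓ ≥ 1`, `|z| = 2ℓ`, `k = 4|bin D(ℓ)|` and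
`k + ℓ + 2^{k+1} ℓ ≤ |ρ|`, `h ⟨⟨y, z⟩, ρ⟩` is the truth table of the leaf-bit (bit `0`)
function of the depth-`k` distinguisher tree of the halves of `s ↦ G ⟨y, s⟩`, with step number
`ρ[0, k)`, root label `ρ[k, k+ℓ)`, fresh labels the blocks `ρ[k+ℓ+(2t+b)ℓ, +ℓ)` and challenge the
halves of `z`: parse, then loop over the leaves `t = 2ᵏ−1, …, 0` prepending the first bit of the
label of leaf `t` (`exists_walk`). [cite: AllenderEtAl2006, Thm. 45 (proof, p. 24)]
[cite: RazborovRudich1997, Thm. 4.1 proof] [cite: AroraBarak2009, §1.3 and proof of Thm. 9.17] -/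
theorem exists_tableFunction {G : List Bool → List Bool} (hG : G ∈ FP)
    (hG2 : ∀ y s : List Bool, (G (boolPair y s)).length = 2 * s.length) (D : Polynomial ℕ) :
    ∃ h : List Bool → List Bool, h ∈ FP ∧
      ∀ (ℓ : ℕ) (hℓ : 0 < ℓ) (y z ρ : List Bool), z.length = 2 * ℓ →
        4 * Nat.size (D.eval ℓ) + ℓ + 2 ^ (4 * Nat.size (D.eval ℓ) + 1) * ℓ ≤ ρ.length →
        h (boolPair (boolPair y z) ρ) =
          truthTable (distFun
            (fun (b : Bool) (s' : Fin ℓ → Bool) (j : Fin ℓ) =>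
              (G (boolPair y (List.ofFn s'))).getD (cond b (ℓ + j) j) false)
            (fun s' : Fin ℓ → Bool => s' ⟨0, hℓ⟩)
            ((fun j : Fin ℓ => ρ.getD (4 * Nat.size (D.eval ℓ) + j) false),
              fun (t : Fin (2 ^ (4 * Nat.size (D.eval ℓ)))) (b : Bool) (j : Fin ℓ) =>
                ρ.getD (4 * Nat.size (D.eval ℓ) + ℓ + (2 * t + cond b 1 0) * ℓ + j) false)
            (boolFunEquivFin (4 * Nat.size (D.eval ℓ)) fun t => ρ.getD t false)
            (fun (b : Bool) (j : Fin ℓ) => z.getD (cond b (ℓ + j) j) false)) := by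
  obtain ⟨walk, hwalkFP, hwalk⟩ := exists_walk hG
  -- parsing the input `P = ⟨⟨y, z⟩, ρ⟩`
  let py : List Bool → List Bool := fstF ∘ fstF
  let pz : List Bool → List Bool := sndF ∘ fstF
  let pρ : List Bool → List Bool := sndF
  let uℓF : List Bool → List Bool := halfFn ∘ pz                    -- `1^ℓ`
  let sUF : List Bool → List Bool := onesFn ∘ lenBinF ∘ polyFn D ∘ uℓF  -- `1^{|bin D(ℓ)|}`
  let ukF : List Bool → List Bool :=                                    -- `1ᵏ`
    appF ∘ fanoutFn (appF ∘ fanoutFn sUF sUF) (appF ∘ fanoutFn sUF sUF)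
  let bkF : List Bool → List Bool := lenBinF ∘ ukF                      -- `bin k`
  let ρ'F : List Bool → List Bool := dropFn ∘ fanoutFn (appF ∘ fanoutFn ukF uℓF) pρ  -- `ρ ⇂ (k+ℓ)`
  let x0F : List Bool → List Bool := takeFn ∘ fanoutFn uℓF (dropFn ∘ fanoutFn ukF pρ) -- `ρ[k, k+ℓ)`
  let biF : List Bool → List Bool := norm ∘ takeFn ∘ fanoutFn ukF pρ    -- `bin i`
  let b2kF : List Bool → List Bool := powFn 1 ∘ ukF                     -- `bin 2ᵏ`
  let X0F : List Bool → List Bool :=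
    fanoutFn py (fanoutFn pz (fanoutFn ρ'F (fanoutFn uℓF (fanoutFn bkF (fanoutFn biF x0F)))))
  let initF : List Bool → List Bool := fanoutFn X0F (fanoutFn b2kF fun _ => [])
  -- the outer loop on `Z = ⟨X₀, ⟨cnt, acc⟩⟩`, `X₀ = ⟨y, ⟨z, ⟨ρ', ⟨1^ℓ, ⟨bin k, ⟨bin i, x₀⟩⟩⟩⟩⟩⟩`
  let oX : List Bool → List Bool := nthF 0
  let ocnt : List Bool → List Bool := nthF 1
  let oacc : List Bool → List Bool := sndPow 1
  let btF : List Bool → List Bool := subFn ∘ fanoutFn ocnt fun _ => encodeNat 1   -- `bin (c-1)`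
  let XF : List Bool → List Bool :=
    fanoutFn (nthF 0 ∘ oX) (fanoutFn (nthF 1 ∘ oX) (fanoutFn (nthF 2 ∘ oX)
      (fanoutFn (nthF 3 ∘ oX) (fanoutFn (nthF 4 ∘ oX) (fanoutFn (nthF 5 ∘ oX) btF)))))
  let inF : List Bool → List Bool := fanoutFn XF (sndPow 5 ∘ oX)
  let body : List Bool → List Bool := appF ∘ fanoutFn (headBitFn ∘ walk ∘ inF) oacc
  let loop : List Bool → List Bool := fun w =>
    (loopStep body)^[(Polynomial.X : Polynomial ℕ).eval (fstF w).length] w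
  let h : List Bool → List Bool := sndPow 1 ∘ loop ∘ initF
  -- membership in `FP`
  have hpy : py ∈ FP := comp_mem_FP fstF_mem_FP fstF_mem_FP
  have hpz : pz ∈ FP := comp_mem_FP sndF_mem_FP fstF_mem_FP
  have hpρ : pρ ∈ FP := sndF_mem_FP
  have huℓ : uℓF ∈ FP := comp_mem_FP halfFn_mem_FP hpz
  have hsU : sUF ∈ FP := comp_mem_FP onesFn_mem_FP
    (comp_mem_FP lenBinF_mem_FP (comp_mem_FP (polyFn_mem_FP D) huℓ))
  have huk : ukF ∈ FP := comp_mem_FP appF_mem_FP (fanoutFn_mem_FP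
    (comp_mem_FP appF_mem_FP (fanoutFn_mem_FP hsU hsU))
    (comp_mem_FP appF_mem_FP (fanoutFn_mem_FP hsU hsU)))
  have hbk : bkF ∈ FP := comp_mem_FP lenBinF_mem_FP huk
  have hρ' : ρ'F ∈ FP := comp_mem_FP dropFn_mem_FP
    (fanoutFn_mem_FP (comp_mem_FP appF_mem_FP (fanoutFn_mem_FP huk huℓ)) hpρ)
  have hx0 : x0F ∈ FP := comp_mem_FP takeFn_mem_FP
    (fanoutFn_mem_FP huℓ (comp_mem_FP dropFn_mem_FP (fanoutFn_mem_FP huk hpρ)))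
  have hbi : biF ∈ FP := comp_mem_FP norm_mem_FP
    (comp_mem_FP takeFn_mem_FP (fanoutFn_mem_FP huk hpρ))
  have hb2k : b2kF ∈ FP := comp_mem_FP (powFn_mem_FP 1) huk
  have hX0 : X0F ∈ FP := fanoutFn_mem_FP hpy (fanoutFn_mem_FP hpz (fanoutFn_mem_FP hρ'
    (fanoutFn_mem_FP huℓ (fanoutFn_mem_FP hbk (fanoutFn_mem_FP hbi hx0)))))
  have hinit : initF ∈ FP := fanoutFn_mem_FP hX0 (fanoutFn_mem_FP hb2k (const_mem_FP _))
  have hoX : oX ∈ FP := nthF_mem_FP 0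
  have hbt : btF ∈ FP := comp_mem_FP subFn_mem_FP (fanoutFn_mem_FP (nthF_mem_FP 1) (const_mem_FP _))
  have hXF : XF ∈ FP := fanoutFn_mem_FP (comp_mem_FP (nthF_mem_FP 0) hoX)
    (fanoutFn_mem_FP (comp_mem_FP (nthF_mem_FP 1) hoX) (fanoutFn_mem_FP (comp_mem_FP (nthF_mem_FP 2) hoX)
      (fanoutFn_mem_FP (comp_mem_FP (nthF_mem_FP 3) hoX) (fanoutFn_mem_FP (comp_mem_FP (nthF_mem_FP 4) hoX)
        (fanoutFn_mem_FP (comp_mem_FP (nthF_mem_FP 5) hoX) hbt)))))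
  have hinF : inF ∈ FP := fanoutFn_mem_FP hXF (comp_mem_FP (sndPow_mem_FP 5) hoX)
  have hbody : body ∈ FP := comp_mem_FP appF_mem_FP (fanoutFn_mem_FP
    (comp_mem_FP headBitFn_mem_FP (comp_mem_FP hwalkFP hinF)) (sndPow_mem_FP 1))
  have hloop : loop ∈ FP := by
    refine loopFn_mem_FP hbody (c := 1) (fun w => ?_) Polynomial.X
    have : (body w).length = (sndPow 1 w).length + 1 := by
      simp only [body, Function.comp_apply, fanoutFn_apply, appF_boolPair, headBitFn_apply,
        List.length_append, List.length_cons, List.length_nil, oacc]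
      omega
    rw [this]
    nlinarith
  have hh : h ∈ FP := comp_mem_FP (sndPow_mem_FP 1) (comp_mem_FP hloop hinit)
  refine ⟨h, hh, ?_⟩
  -- semantics
  intro ℓ hℓ y z ρ hz hK
  -- the numbers
  generalize hk : 4 * Nat.size (D.eval ℓ) = k at hK ⊢
  have hkℓρ : k + ℓ ≤ ρ.length := le_trans (Nat.le_add_right _ _) hK
  have hkρ : k ≤ ρ.length := le_trans (Nat.le_add_right _ _) hkℓρ
  obtain ⟨i, hi⟩ : ∃ i : ℕ, i = bitsToNat (ρ.take k) := ⟨_, rfl⟩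
  have hi_lt : i < 2 ^ k := by
    have h1 := bitsToNat_lt (ρ.take k)
    rw [List.length_take, min_eq_left hkρ] at h1
    rwa [hi]
  have hival : ((boolFunEquivFin k fun t : Fin k => ρ.getD t false) : ℕ) = i := by
    rw [hi]; exact boolFunEquivFin_getD_eq_bitsToNat_take ρ hkρ
  -- opaque names
  obtain ⟨X₀, hX₀⟩ : ∃ X₀ : List Bool, X₀ = boolPair y (boolPair z (boolPair (ρ.drop (k + ℓ))
      (boolPair (ones ℓ) (boolPair (encodeNat k) (boolPair (encodeNat i) ((ρ.drop k).take ℓ)))))) :=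
    ⟨_, rfl⟩
  -- parsing
  have hzhalf : z.length / 2 = ℓ := by rw [hz]; omega
  have vuℓ : uℓF (boolPair (boolPair y z) ρ) = ones ℓ := by
    simp only [uℓF, pz, Function.comp_apply, fstF_boolPair, sndF_boolPair, halfFn, hzhalf]
  have vsU : sUF (boolPair (boolPair y z) ρ) = ones (Nat.size (D.eval ℓ)) := by
    simp only [sUF, Function.comp_apply, vuℓ, polyFn_apply, lenBinF_apply, onesFn_eq_ones,
      TM2Pass.length_encodeNat_eq_size]
    simp [ones]
  have vuk : ukF (boolPair (boolPair y z) ρ) = ones k := by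
    simp only [ukF, Function.comp_apply, fanoutFn_apply, vsU, appF_boolPair, Com.ones_append, ← hk]
    congr 1
    ring
  have vbk : bkF (boolPair (boolPair y z) ρ) = encodeNat k := by
    simp only [bkF, Function.comp_apply, vuk, lenBinF_apply]
    simp [ones]
  have vρ' : ρ'F (boolPair (boolPair y z) ρ) = ρ.drop (k + ℓ) := by
    simp only [ρ'F, pρ, Function.comp_apply, fanoutFn_apply, vuk, vuℓ, appF_boolPair, sndF_boolPair,
      dropFn_boolPair, Com.ones_append]
    simp [ones]
  have vx0 : x0F (boolPair (boolPair y z) ρ) = (ρ.drop k).take ℓ := by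
    simp only [x0F, pρ, Function.comp_apply, fanoutFn_apply, vuk, vuℓ, sndF_boolPair,
      dropFn_boolPair, takeFn_boolPair]
    simp [ones]
  have vbi : biF (boolPair (boolPair y z) ρ) = encodeNat i := by
    simp only [biF, pρ, Function.comp_apply, fanoutFn_apply, vuk, sndF_boolPair, takeFn_boolPair,
      norm_eq_encodeNat, hi]
    simp [ones]
  have vb2k : b2kF (boolPair (boolPair y z) ρ) = encodeNat (2 ^ k) := by
    simp only [b2kF, Function.comp_apply, vuk, powFn_one_ones']
  have vX0 : X0F (boolPair (boolPair y z) ρ) = X₀ := by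
    simp only [X0F, py, pz, Function.comp_apply, fanoutFn_apply, fstF_boolPair, sndF_boolPair,
      vρ', vuℓ, vbk, vbi, vx0, hX₀]
  have vinit : initF (boolPair (boolPair y z) ρ) = boolPair X₀ (boolPair (encodeNat (2 ^ k)) []) := by
    simp only [initF, fanoutFn_apply, vX0, vb2k]
  -- the bits of the table
  have hGℓ : ∀ s : List Bool, s.length = ℓ → (G (boolPair y s)).length = 2 * ℓ :=
    fun s hs => by rw [hG2, hs]
  have hwalkt : ∀ (t : ℕ) (ht : t < 2 ^ k),
      walk (boolPair (boolPair y (boolPair z (boolPair (ρ.drop (k + ℓ)) (boolPair (ones ℓ)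
        (boolPair (encodeNat k) (boolPair (encodeNat i) (encodeNat t))))))) ((ρ.drop k).take ℓ)) =
        List.ofFn (distLab
          (fun (b : Bool) (s : Fin ℓ → Bool) (j : Fin ℓ) =>
            (G (boolPair y (List.ofFn s))).getD (cond b (ℓ + j) j) false)
          (Sample.rho (σ := Fin ℓ → Bool) (n := k)
            ((fun j : Fin ℓ => ρ.getD (k + j) false),
              fun (t' : Fin (2 ^ k)) (b : Bool) (j : Fin ℓ) =>
                ρ.getD (k + ℓ + (2 * t' + cond b 1 0) * ℓ + j) false))
          (fun j : Fin ℓ => ρ.getD (k + j) false) i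
          (fun (b : Bool) (j : Fin ℓ) => z.getD (cond b (ℓ + j) j) false)
          k ((boolFunEquivFin k).symm ⟨t, ht⟩)) :=
    fun t ht => hwalk y z ρ ℓ k i t ht hℓ hi_lt hz hGℓ hK
  -- one round of the outer loop: counter `c + 1` prepends bit `c`
  have hround : ∀ (c : ℕ) (hc : c < 2 ^ k) (acc : List Bool),
      body (boolPair X₀ (boolPair (encodeNat (c + 1)) acc)) =
        (List.ofFn (distLab
          (fun (b : Bool) (s : Fin ℓ → Bool) (j : Fin ℓ) =>
            (G (boolPair y (List.ofFn s))).getD (cond b (ℓ + j) j) false)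
          (Sample.rho (σ := Fin ℓ → Bool) (n := k)
            ((fun j : Fin ℓ => ρ.getD (k + j) false),
              fun (t' : Fin (2 ^ k)) (b : Bool) (j : Fin ℓ) =>
                ρ.getD (k + ℓ + (2 * t' + cond b 1 0) * ℓ + j) false))
          (fun j : Fin ℓ => ρ.getD (k + j) false) i
          (fun (b : Bool) (j : Fin ℓ) => z.getD (cond b (ℓ + j) j) false)
          k ((boolFunEquivFin k).symm ⟨c, hc⟩))).headD false :: acc := by
    intro c hc acc
    have hin : inF (boolPair X₀ (boolPair (encodeNat (c + 1)) acc)) =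
        boolPair (boolPair y (boolPair z (boolPair (ρ.drop (k + ℓ)) (boolPair (ones ℓ)
          (boolPair (encodeNat k) (boolPair (encodeNat i) (encodeNat c))))))) ((ρ.drop k).take ℓ) := by
      simp only [inF, XF, btF, oX, ocnt, Function.comp_apply, fanoutFn_apply, hX₀, nthF_zero_boolPair,
        nthF_succ_boolPair, sndPow_succ_boolPair, sndPow_zero_boolPair, subFn_boolPair,
        bitsToNat_encodeNat, Nat.add_sub_cancel]
    simp only [body, oacc, Function.comp_apply, fanoutFn_apply, appF_boolPair, headBitFn_apply,
      sndPow_succ_boolPair, sndPow_zero_boolPair, hin, hwalkt c hc, List.singleton_append]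
  -- the loop lists the bits `t < c` in front of the accumulator
  have hmodel : ∀ (c : ℕ) (hc : c ≤ 2 ^ k) (acc : List Bool),
      loopModel body X₀ c acc =
        List.ofFn (fun t : Fin c => (List.ofFn (distLab
          (fun (b : Bool) (s : Fin ℓ → Bool) (j : Fin ℓ) =>
            (G (boolPair y (List.ofFn s))).getD (cond b (ℓ + j) j) false)
          (Sample.rho (σ := Fin ℓ → Bool) (n := k)
            ((fun j : Fin ℓ => ρ.getD (k + j) false),
              fun (t' : Fin (2 ^ k)) (b : Bool) (j : Fin ℓ) =>
                ρ.getD (k + ℓ + (2 * t' + cond b 1 0) * ℓ + j) false))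
          (fun j : Fin ℓ => ρ.getD (k + j) false) i
          (fun (b : Bool) (j : Fin ℓ) => z.getD (cond b (ℓ + j) j) false)
          k ((boolFunEquivFin k).symm ⟨t, lt_of_lt_of_le t.isLt hc⟩))).headD false) ++ acc := by
    intro c
    induction c with
    | zero => intro _ acc; simp [loopModel]
    | succ c ih =>
      intro hc acc
      rw [loopModel, hround c (by omega) acc, ih (by omega), List.ofFn_succ', List.concat_eq_append,
        List.append_assoc]
      rfl
  -- run the machine
  have hX₀len : 2 ^ k ≤ X₀.length := by
    rw [hX₀]
    simp only [length_boolPair, List.length_drop]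
    have : 2 ^ k ≤ 2 ^ (k + 1) * ℓ := by
      rw [pow_succ]
      calc 2 ^ k ≤ 2 ^ k * 2 := Nat.le_mul_of_pos_right _ two_pos
        _ ≤ 2 ^ k * 2 * ℓ := Nat.le_mul_of_pos_right _ hℓ
    omega
  have hrun : h (boolPair (boolPair y z) ρ) = loopModel body X₀ (2 ^ k) [] := by
    simp only [h, loop, Function.comp_apply, vinit, fstF_boolPair, Polynomial.eval_X]
    rw [iterate_loopStep body X₀ (2 ^ k) X₀.length [] hX₀len]
    simp
  rw [hrun, hmodel (2 ^ k) le_rfl [], List.append_nil]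
  -- compare with the truth table, entry by entry
  apply List.ext_getElem
  · simp
  · intro t h1 h2
    rw [List.getElem_ofFn]
    have ht : t < 2 ^ k := by simpa using h1
    have hR := getD_truthTable_distFun (σ := Fin ℓ → Bool)
      (fun (b : Bool) (s : Fin ℓ → Bool) (j : Fin ℓ) =>
        (G (boolPair y (List.ofFn s))).getD (cond b (ℓ + j) j) false)
      (fun s' : Fin ℓ → Bool => s' ⟨0, hℓ⟩)
      ((fun j : Fin ℓ => ρ.getD (k + j) false),
        fun (t' : Fin (2 ^ k)) (b : Bool) (j : Fin ℓ) =>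
          ρ.getD (k + ℓ + (2 * t' + cond b 1 0) * ℓ + j) false)
      (boolFunEquivFin k fun t => ρ.getD t false)
      (fun (b : Bool) (j : Fin ℓ) => z.getD (cond b (ℓ + j) j) false) ⟨t, ht⟩
    rw [List.getD_eq_getElem _ _ h2] at hR
    rw [hR, headD_ofFn hℓ, hival]

end Literature.Computability.MetaComplexity
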